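import Literature.Topology.FourManifolds.LatticeFormsStableOrthogonalGroupIndex
import Literature.Topology.FourManifolds.LatticeFormsTwoElementary
import HarnessLib

/-!
# `−id` and the stable orthogonal group: `(−id)‾ = −id_{A_L}`, so `−id ∈ Õ(L)` iff `L` is `2`-elementary;
# `−id ∈ Õ(Λ_d)` iff `d = 1` (Gritsenko–Hulek–Sankaran, Doc. Math. 12 (2007), §4)

Sequel of `LatticeFormsStableOrthogonalGroupIndex.lean` (row g39-#3: `[O(L) : Õ(L)] = |O(q_L)|`,
`|O(q_{Λ_d})| = 2^{ρ(d)}`), of `LatticeFormsRankOneDiscriminantFormIsometries.lean` (g39-#1: `(−1)‾ a = −a`,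
`A_{ℤ(2n)} = ℤ/2n · [i(1)]`) and of `LatticeFormsTwoElementary.lean` (`IsTwoElementary B : 2 · A_B = 0`). Written for
lane `lit-hodgefound` (Track 2 foundations; prover seat `lit-hodgefound-p18`, gen 39, row g39-#6). THEOREMS ONLY — no
definition, no named fact, no instance, no notation; `−id = LinearMap.BilinForm.IsometryEquiv.neg`,
"`−id ∈ Õ(L)`" = `(−id)‾ = LinearEquiv.refl`.

## Source, verbatim (held text `paper:arxiv-math_0512595`)

* §4, after Lemma 4.2 (p. 9): "Finally, we want to consider the projective groups `PO(L)`, `PO⁺(L)` and `PÕ⁺(L)`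
  […] `[PO(L) : PÕ⁺(L)] = N` if `−id ∉ Õ⁺(L)`, `2N` if `−id ∈ Õ⁺(L)`. Note that `−id ∈ Õ⁺(L)` if and only if
  `A_L` is a `2`-group." — read: an ELEMENTARY abelian `2`-group (`−id` acts on `A_L` as `−1`, which is the
  identity iff `2·A_L = 0`; e.g. for `A_L = ℤ/4` it is not), consistent with the next item.
* after Lemma 4.3 (p. 11): "`[PO(L_{2d}) : PÕ⁺(L_{2d})] = 2^{ρ(d)}` if `d > 1`, and `2` if `d = 1`" — for
  `L_{2d}` (`A ≅ ℤ/2d`) the second branch occurs exactly when `−id ∈ Õ(L_{2d})`, i.e. `d = 1`.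

## Contents (all proved)

* §1 `discriminantGroupCongr_neg_eq_refl_iff_isTwoElementary`: `(−id)‾ = id ⟺ L` is `2`-elementary (any lattice).
* §2 `isTwoElementary_twoMul_smul_mul_iff` (`ℤ(2d)`: iff `d = 1`), `isTwoElementary_neg_twoMul_smul_mul_iff`
  (`⟨−2d⟩`), `isTwoElementary_restrict_orthogonal_iff` (`ℓ^⊥` for a primitive `ℓ`, `(ℓ)² = 2d > 0`, in an even
  unimodular `Λ`: iff `d = 1`).
* §3 `discriminantGroupCongr_neg_restrict_orthogonal_eq_refl_iff`, `…_k3Lattice_orthogonal_…` (`Λ_d ⊂ Λ_{K3}`),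
  `discriminantGroupCongr_neg_latticeL2d_eq_refl_iff` (the model `L_{2d}`): **`−id ∈ Õ ⟺ d = 1`**.

NOT here: `O⁺`, the projective groups and the index `[PO(L) : PÕ⁺(L)]` itself.

## References

* [GritsenkoHulekSankaran2007HM] V. Gritsenko, K. Hulek, G. K. Sankaran, The Hirzebruch–Mumford volume for the
  orthogonal group and applications, Doc. Math. 12 (2007) 215–241 (arXiv:math/0512595), §4.
* [AlexeevNikulin2006] V. Alexeev, V. V. Nikulin, Del Pezzo and K3 surfaces, MSJ Memoirs 15 (2006), §2.2.
* [Huybrechts2016K3] D. Huybrechts, Lectures on K3 Surfaces, CUP 2016, Ch. 6 §3.2; Ch. 14 §0.2–0.3, Ex. 1.11 (i).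
-/

noncomputable section

open Module Function
open LinearMap (BilinForm)
open LinearMap.BilinForm
open Literature.AlgebraicGeometry.Surfaces

namespace Literature.Topology.FourManifolds

universe u

/-! ### §1 `(−id)‾ = −id_{A_L}`; `−id ∈ Õ(L)` iff `L` is `2`-elementary -/

section NegId

variable {P : Type u} [AddCommGroup P] (B : BilinForm ℤ P)

/-- **`−id ∈ Õ(L)` iff `A_L` is an elementary abelian `2`-group**: `(−id_L)‾ = −id_{A_L}`, so `−id` acts
trivially on the discriminant group iff `−a = a`, i.e. `2a = 0`, for all `a ∈ A_L` (GHS: "Note that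
`−id ∈ Õ⁺(L)` if and only if `A_L` is a `2`-group" — read: `2·A_L = 0`).
[cite: GritsenkoHulekSankaran2007HM, §4 after Lemma 4.2 ("`−id ∈ Õ⁺(L)` if and only if `A_L` is a `2`-group")] [cite: AlexeevNikulin2006, §2.2] -/
theorem discriminantGroupCongr_neg_eq_refl_iff_isTwoElementary :
    (LinearMap.BilinForm.IsometryEquiv.neg B).discriminantGroupCongr = LinearEquiv.refl ℤ B.discriminantGroup ↔
      B.IsTwoElementary := by
  rw [isTwoElementary_iff_forall_neg_eq]
  refine ⟨fun h a ↦ ?_, fun h ↦ LinearEquiv.ext fun a ↦ ?_⟩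
  · rw [← discriminantGroupCongr_neg_apply B a, h, LinearEquiv.refl_apply]
  · rw [discriminantGroupCongr_neg_apply, LinearEquiv.refl_apply, h a]

end NegId

/-! ### §2 `ℤ(2d)`, `⟨−2d⟩` and `ℓ^⊥` are `2`-elementary iff `d = 1` -/

section RankOne

variable (d : ℕ)

/-- **`A_{ℤ(2d)} = ℤ/2d` is `2`-elementary iff `d = 1`.** [cite: GritsenkoHulekSankaran2007HM, §4 Lemma 4.3 and (after it) "`2` if `d = 1`"] [cite: Huybrechts2016K3, Ch. 14 §0.3 (iv)] -/
theorem isTwoElementary_twoMul_smul_mul_iff (hd : 0 < d) :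
    BilinForm.IsTwoElementary ((2 * d : ℤ) • LinearMap.mul ℤ ℤ) ↔ d = 1 := by
  constructor
  · intro h
    have h1 := h (Submodule.Quotient.mk (LinearMap.mul ℤ ℤ 1))
    rw [zsmul_mk_mul d 2 1, mul_one, mk_mul_eq_zero_iff d 2] at h1
    have := Int.le_of_dvd (by norm_num) h1
    omega
  · rintro rfl a
    obtain ⟨x, rfl⟩ := exists_eq_mk_mul 1 a
    rw [zsmul_mk_mul 1 2 x, mk_mul_eq_zero_iff 1]
    exact ⟨x, by ring⟩

/-- **`A_{⟨−2d⟩}` is `2`-elementary iff `d = 1`** (same group as `A_{ℤ(2d)}`).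
[cite: GritsenkoHulekSankaran2007HM, §4 Lemma 4.3] -/
theorem isTwoElementary_neg_twoMul_smul_mul_iff (hd : 0 < d) :
    BilinForm.IsTwoElementary ((-(2 * d : ℤ)) • LinearMap.mul ℤ ℤ) ↔ d = 1 := by
  obtain ⟨h₁', h₂', h₃'⟩ := nondegenerate_isSymm_isEven_neg_twoMul_smul_mul d hd
  obtain ⟨φ, -⟩ := exists_antiIsometry_twoMul_smul_mul_neg d hd (nondegenerate_twoMul_smul_mul d hd)
    (isSymm_twoMul_smul_mul d) (isEven_twoMul_smul_mul d) h₁' h₂' h₃'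
  rw [← isTwoElementary_iff_of_addEquiv φ.toAddEquiv, isTwoElementary_twoMul_smul_mul_iff d hd]

variable {V : Type u} [AddCommGroup V] [Module.Finite ℤ V] [Module.Free ℤ V] (Λ : BilinForm ℤ V)

/-- **`ℓ^⊥` is `2`-elementary iff `(ℓ)² = 2`**: for a primitive `ℓ` with `(ℓ)² = 2d > 0` in an even unimodular `Λ`,
`A_{ℓ^⊥} ≅ A_{ℤℓ} ≅ ℤ/2d`. [cite: GritsenkoHulekSankaran2007HM, §4 (after Lemma 4.3)] [cite: Huybrechts2016K3, Ch. 14 §0.2 Prop. 0.2 (i), Example 1.11 (i)] -/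
theorem isTwoElementary_restrict_orthogonal_iff (hs : Λ.IsSymm) (hu : Λ.IsUnimodular) (he : Λ.IsEven) (hd : 0 < d)
    {ℓ : V} (hℓ : Λ ℓ ℓ = 2 * d) (hℓsat : ∀ (k : ℤ) (w : V), k ≠ 0 → k • w ∈ ℤ ∙ ℓ → w ∈ ℤ ∙ ℓ) :
    (Λ.restrict (Λ.orthogonal (ℤ ∙ ℓ))).IsTwoElementary ↔ d = 1 := by
  haveI : Λ.IsPerfPair := hu
  have hℓ0' : Λ ℓ ℓ ≠ 0 := by rw [hℓ]; positivity
  have hnd : (Λ.restrict (ℤ ∙ ℓ)).Nondegenerate := nondegenerate_restrict_span_singleton Λ hℓ0'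
  have hC := nondegenerate_restrict_orthogonal Λ (ℤ ∙ ℓ) hs hℓsat hnd
  obtain ⟨φ, -⟩ := exists_antiIsometry_twoMul_smul_mul_restrict_orthogonal d Λ hs hu he hd hℓ hℓsat
    (nondegenerate_twoMul_smul_mul d hd) (isSymm_twoMul_smul_mul d) (isEven_twoMul_smul_mul d) hC (hs.restrict _)
    (isEven_restrict he _)
  rw [← isTwoElementary_iff_of_addEquiv φ.toAddEquiv, isTwoElementary_twoMul_smul_mul_iff d hd]

end RankOne

/-! ### §3 `−id ∈ Õ(Λ_d)` iff `d = 1` -/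

section K3

variable (d : ℕ)

/-- **`−id ∈ Õ(ℓ^⊥)` iff `d = 1`** for a primitive `ℓ` with `(ℓ)² = 2d > 0` in an even unimodular lattice `Λ`
(e.g. `Λ_d = ℓ^⊥ ⊂ Λ_{K3}`): `−id` acts as `−1` on `A_{ℓ^⊥} ≅ ℤ/2d`. This is the dichotomy behind GHS's
"`[PO(L_{2d}) : PÕ⁺(L_{2d})] = 2^{ρ(d)}` if `d > 1`, and `2` if `d = 1`".
[cite: GritsenkoHulekSankaran2007HM, §4 after Lemma 4.2 and after Lemma 4.3] -/
theorem discriminantGroupCongr_neg_restrict_orthogonal_eq_refl_iff {V : Type u} [AddCommGroup V]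
    [Module.Finite ℤ V] [Module.Free ℤ V] (Λ : BilinForm ℤ V) (hs : Λ.IsSymm) (hu : Λ.IsUnimodular) (he : Λ.IsEven)
    (hd : 0 < d) {ℓ : V} (hℓ : Λ ℓ ℓ = 2 * d)
    (hℓsat : ∀ (k : ℤ) (w : V), k ≠ 0 → k • w ∈ ℤ ∙ ℓ → w ∈ ℤ ∙ ℓ) :
    (LinearMap.BilinForm.IsometryEquiv.neg (Λ.restrict (Λ.orthogonal (ℤ ∙ ℓ)))).discriminantGroupCongr =
        LinearEquiv.refl ℤ _ ↔ d = 1 := by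
  rw [discriminantGroupCongr_neg_eq_refl_iff_isTwoElementary,
    isTwoElementary_restrict_orthogonal_iff d Λ hs hu he hd hℓ hℓsat]

/-- **`−id ∈ Õ(Λ_d)` iff `d = 1`, for `Λ_d = ℓ^⊥ ⊂ Λ_{K3}`** (`ℓ` primitive, `(ℓ)² = 2d > 0`).
[cite: GritsenkoHulekSankaran2007HM, §4 after Lemma 4.2 and after Lemma 4.3] [cite: Huybrechts2016K3, Ch. 6 §3.2] -/
theorem discriminantGroupCongr_neg_k3Lattice_orthogonal_eq_refl_iff (hd : 0 < d) {ℓ : K3Index → ℤ}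
    (hℓ : Matrix.toBilin' k3Gram ℓ ℓ = 2 * d)
    (hℓsat : ∀ (k : ℤ) (w : K3Index → ℤ), k ≠ 0 → k • w ∈ ℤ ∙ ℓ → w ∈ ℤ ∙ ℓ) :
    (LinearMap.BilinForm.IsometryEquiv.neg ((Matrix.toBilin' k3Gram).restrict
        ((Matrix.toBilin' k3Gram).orthogonal (ℤ ∙ ℓ)))).discriminantGroupCongr = LinearEquiv.refl ℤ _ ↔ d = 1 :=
  discriminantGroupCongr_neg_restrict_orthogonal_eq_refl_iff d _ isSymm_toBilin'_k3Gram isUnimodular_toBilin'_k3Gram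
    isEven_toBilin'_k3Gram hd hℓ hℓsat

/-- **The model: `L_{2d} = E₈(−1)^{⊕2} ⊕ U^{⊕2} ⊕ ℤ(−2d)` is `2`-elementary iff `d = 1`, i.e. `−id ∈ Õ(L_{2d})` iff
`d = 1`.** [cite: GritsenkoHulekSankaran2007HM, §4 after Lemma 4.2 ("`−id ∈ Õ⁺(L)` if and only if `A_L` is a `2`-group") and after Lemma 4.3 ("`2` if `d = 1`")] -/
theorem discriminantGroupCongr_neg_latticeL2d_eq_refl_iff (hd : 0 < d) :
    (LinearMap.BilinForm.IsometryEquiv.neg (((LinearMap.BilinForm.pi fun _ : Fin 2 ↦ -e8Form).prod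
        (hyperbolicSum 2)).prod ((-(2 * d : ℤ)) • LinearMap.mul ℤ ℤ))).discriminantGroupCongr =
        LinearEquiv.refl ℤ _ ↔ d = 1 := by
  obtain ⟨ℓ, hℓ, hℓ0, hℓsat⟩ := k3Lattice_exists_primitive_sq_eq (d : ℤ)
  obtain ⟨e⟩ := k3Lattice_restrict_orthogonal_equivalent hℓ hℓ0 hℓsat
  rw [discriminantGroupCongr_neg_eq_refl_iff_isTwoElementary, ← e.isTwoElementary_iff,
    ← discriminantGroupCongr_neg_eq_refl_iff_isTwoElementary]
  exact discriminantGroupCongr_neg_k3Lattice_orthogonal_eq_refl_iff d hd hℓ hℓsat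

end K3

end Literature.Topology.FourManifolds

end
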